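import Literature.GroupTheory.CombinatorialGroupTheory.FreeGroupBigPowersCore
import Mathlib.Algebra.Group.Conj
import HarnessLib

/-!
# Baumslag's big powers lemma for free groups (alternating / Dehn-twist form)

Topic `Literature/GroupTheory/CombinatorialGroupTheory`; theorems only; part III, over
`FreeGroupPowerWords.lean` and `FreeGroupBigPowersCore.lean`.

**Theorem** (G. Baumslag, *On generalised free products*, Math. Z. 78 (1962) 423–438, Prop. 1
— free groups have the *big powers property*; text not held here (acq-11105), locator after the tree's bib entry): if `z ≠ 1` in a free group and
`y₁, …, y_k` do not commute with `z`, then products `z^{e₀} y₁ z^{e₁} y₂ ⋯ y_k z^{e_k}` with all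
interior exponents large in absolute value are `≠ 1`.  We prove it in the ALTERNATING shape in
which the tree's amalgam combination lemma consumes it
(`AmalgamDiscrimination.exists_twistLift_forall_ne_one`, hypothesis `hBP`; abc-iut cell, [IUTchI]
Lem. 2.7 surface half via full residual freeness of surface groups):

* `FreeGroup.exists_bigPowers_alternating` — for `z ≠ 1`, `c ∈ ℤ`, and a nonempty list
  `(t₁,y₁), …, (t_k,y_k)` with alternating flags `tⱼ ≠ tⱼ₊₁` and every `yⱼ ∉ C(z)`:
  `∃ N, ∀ m, N ≤ |m| → z^c · ∏ⱼ z^{m tⱼ} yⱼ z^{-m tⱼ} ≠ 1`.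

Proof.  Conjugating by the `conjugator` of `z.toWord` (Mathlib `FreeGroup.reduceCyclically`) we may
assume `z.toWord` cyclically reduced (`FreeGroupBigPowers.alternating_of_isCyclicallyReduced`).  By
induction over the list from the left (`alternating_invariant`, stated for
`z^c · ∏ⱼ(…) · z^{m(1-t_k)}`): the reduced word of the partial product ends with `|m| - cst`
untouched copies of the word of `z^{±1}`, by the base/step/final engine of part II — each new
factor `yⱼ z^{∓m}` eats fewer than `|P| + |V|` letters of the previous block (`maxCancel_lt`), so for
`|m|` beyond an explicit threshold a full block survives and the next block is again long; a final
factor `y_k` (flag `0`) cannot cancel a long block, and a final block (flag `1`) is nonempty.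
No use of topology or of the ping-pong lemma; everything is cancellation of reduced words.

## References
* G. Baumslag, *On generalised free products*, Math. Z. 78 (1962) 423–438, Prop. 1 (text not held, acq-11105; locator per the tree bib entry). [Baumslag1962]
* R. C. Lyndon, P. E. Schupp, *Combinatorial Group Theory*, Ch. I §2. [LyndonSchupp2001]
-/

namespace Literature.GroupTheory.CombinatorialGroupTheory

open List

universe u

namespace FreeGroupBigPowers

variable {α : Type u} [DecidableEq α]

/-! ### The alternating big powers theorem (the shape consumed by the combination lemma) -/

section Alternating

variable {z : FreeGroup α}

/-- **Invariant of the alternating product** (cyclically reduced `z`).  For a nonempty alternating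
list `ys = [(t₁,y₁),…,(t_k,y_k)]` of elements not commuting with `z`, let `w = z⁻¹` if `t_k` and
`w = z` otherwise; then for `|m|` large the word of
`z^c · ∏ⱼ z^{m tⱼ} yⱼ z^{-m tⱼ} · z^{m(1 - t_k)}` ends with `|m| - cst` untouched copies of the word
of `w^{sign m}`. [cite: Baumslag1962, Prop. 1] -/
theorem alternating_invariant (hz : FreeGroup.IsCyclicallyReduced z.toWord) (hz1 : z ≠ 1) (c : ℤ)
    (ys : List (Bool × FreeGroup α)) (hne : ys ≠ [])
    (halt : ys.IsChain (fun a b => a.1 ≠ b.1)) (hy : ∀ y ∈ ys, ¬ Commute y.2 z) :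
    ∃ N cst : ℕ, 1 ≤ N ∧ ∀ m : ℤ, (N : ℤ) ≤ |m| → cst ≤ m.natAbs ∧ ∃ Z : List (α × Bool),
      (z ^ c * (ys.map fun y => z ^ (m * (y.1.toNat : ℤ)) * y.2 * z ^ (-(m * (y.1.toNat : ℤ)))).prod *
          z ^ (if (ys.getLast hne).1 then (0 : ℤ) else m)).toWord =
        Z ++ (replicate (m.natAbs - cst)
          (if 0 ≤ m then (if (ys.getLast hne).1 then z⁻¹ else z)
            else (if (ys.getLast hne).1 then z⁻¹ else z)⁻¹).toWord).flatten := by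
  induction ys using List.reverseRecOn with
  | nil => exact absurd rfl hne
  | append_singleton ys ty ih =>
    obtain ⟨t, y⟩ := ty
    have hyz : ¬ Commute y z := hy (t, y) (by simp)
    -- the two core lemmas for `y`: blocks `z … z⁻¹` and `z⁻¹ … z`
    have hzi : FreeGroup.IsCyclicallyReduced z⁻¹.toWord := by
      rw [FreeGroup.toWord_inv]; exact isCyclicallyReduced_invRev hz
    have hzi1 : z⁻¹ ≠ 1 := inv_ne_one.mpr hz1
    have hyzi : ¬ Commute y z⁻¹ := fun h => hyz (Commute.inv_right_iff.mp h)
    obtain ⟨A₁, B₁, C₁, hA₁, hB₁, core₁⟩ :=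
      exists_toWord_pow_mul_mul_pow hz hz1 y z⁻¹ (Or.inr ⟨rfl, hyz⟩)
    obtain ⟨A₂, B₂, C₂, hA₂, hB₂, core₂⟩ :=
      exists_toWord_pow_mul_mul_pow hzi hzi1 y z (Or.inr ⟨(inv_inv z).symm, hyzi⟩)
    have hlast : (ys ++ [(t, y)]).getLast hne = (t, y) := by
      rw [getLast_append_of_ne_nil _ (cons_ne_nil _ _)]; rfl
    simp only [hlast, map_append, map_cons, map_nil, prod_append, prod_cons, prod_nil, mul_one]
    by_cases hys : ys = []
    · -- BASE: a single factor
      subst hys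
      simp only [map_nil, prod_nil, one_mul]
      cases t with
      | false =>
        -- `z^c · y · z^m`
        simp only [Bool.toNat_false, Nat.cast_zero, mul_zero, zpow_zero, one_mul, neg_zero,
          mul_one, Bool.false_eq_true, ↓reduceIte]
        obtain ⟨b₁, P₁, hb₁⟩ := exists_toWord_mul_pow hz hz1 (z ^ c * y)
        obtain ⟨b₂, P₂, hb₂⟩ := exists_toWord_mul_pow hzi hzi1 (z ^ c * y)
        refine ⟨max b₁ b₂ + 1, max b₁ b₂, by omega, fun m hm => ?_⟩
        have hm' : max b₁ b₂ + 1 ≤ m.natAbs := by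
          rw [← Int.natCast_natAbs] at hm; exact_mod_cast hm
        refine ⟨by omega, ?_⟩
        rcases le_or_gt 0 m with h0 | h0
        · rw [if_pos h0, zpow_eq_pow_of_nonneg z h0, hb₁ _ (by omega)]
          refine ⟨P₁ ++ (replicate (max b₁ b₂ - b₁) z.toWord).flatten, ?_⟩
          rw [append_assoc, ← flatten_replicate_add]; congr 3; omega
        · rw [if_neg (not_le.mpr h0), zpow_eq_pow_of_neg z h0, hb₂ _ (by omega)]
          refine ⟨P₂ ++ (replicate (max b₁ b₂ - b₂) z⁻¹.toWord).flatten, ?_⟩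
          rw [append_assoc, ← flatten_replicate_add]; congr 3; omega
      | true =>
        -- `z^{c+m} · y · z^{-m}`
        simp only [Bool.toNat_true, Nat.cast_one, mul_one, zpow_zero, ↓reduceIte]
        refine ⟨max A₁ A₂ + c.natAbs + max B₁ B₂ + 1, max B₁ B₂ - 1, by omega, fun m hm => ?_⟩
        have hm' : max A₁ A₂ + c.natAbs + max B₁ B₂ + 1 ≤ m.natAbs := by
          rw [← Int.natCast_natAbs] at hm; exact_mod_cast hm
        refine ⟨by omega, ?_⟩
        rw [show z ^ c * (z ^ m * y * z ^ (-m)) = z ^ (c + m) * y * z ^ (-m) by rw [zpow_add]; group]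
        rcases le_or_gt 0 m with h0 | h0
        · have hcm : 0 ≤ c + m := by omega
          have hx : A₁ ≤ (c + m).natAbs := by omega
          rw [if_pos h0, zpow_eq_pow_of_nonneg z hcm, zpow_eq_pow_of_neg z (by omega),
            Int.natAbs_neg]
          exact exists_repack hB₁ (le_max_left B₁ B₂) (by omega) (core₁ _ _ hx (by omega))
        · have hcm : c + m < 0 := by omega
          have hx : A₂ ≤ (c + m).natAbs := by omega
          rw [if_neg (not_le.mpr h0), inv_inv, zpow_eq_pow_of_neg z hcm,
            zpow_eq_pow_of_nonneg z (by omega), Int.natAbs_neg]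
          exact exists_repack hB₂ (le_max_right B₁ B₂) (by omega) (core₂ _ _ hx (by omega))
    · -- STEP
      have halt' : ys.IsChain (fun a b => a.1 ≠ b.1) := (isChain_append.mp halt).1
      have hy' : ∀ y ∈ ys, ¬ Commute y.2 z := fun y hyy => hy y (mem_append_left _ hyy)
      obtain ⟨N, cst, hN1, H⟩ := ih hys halt' hy'
      have htl : (ys.getLast hys).1 ≠ t :=
        (isChain_append.mp halt).2.2 (ys.getLast hys)
          (by rw [Option.mem_def, getLast?_eq_some_getLast hys]) (t, y) (by simp)
      refine ⟨N + cst + max A₁ A₂ + max B₁ B₂, max B₁ B₂ - 1, by omega, fun m hm => ?_⟩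
      have hm' : N + cst + max A₁ A₂ + max B₁ B₂ ≤ m.natAbs := by
        rw [← Int.natCast_natAbs] at hm; exact_mod_cast hm
      refine ⟨by omega, ?_⟩
      obtain ⟨hcst, Z, hR⟩ := H m (by rw [← Int.natCast_natAbs]; exact_mod_cast (by omega :
        N ≤ m.natAbs))
      have hM₁ : A₁ ≤ m.natAbs - cst := by omega
      have hM₂ : A₂ ≤ m.natAbs - cst := by omega
      cases t with
      | true =>
        have htl' : (ys.getLast hys).1 = false := by simpa using htl
        simp only [htl', Bool.false_eq_true, ↓reduceIte] at hR
        simp only [Bool.toNat_true, Nat.cast_one, mul_one, zpow_zero, mul_one, ↓reduceIte]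
        rcases le_or_gt 0 m with h0 | h0
        · rw [if_pos h0] at hR ⊢
          obtain ⟨Z', h⟩ := exists_step_repack hz1 hA₁ hB₁ (le_max_left B₁ B₂) core₁ hR hM₁
            (le_trans (by omega : max B₁ B₂ ≤ m.natAbs) le_rfl)
          refine ⟨Z', ?_⟩
          rw [← h, zpow_eq_pow_of_neg z (show -m < 0 by omega), Int.natAbs_neg]
          congr 1
          simp only [mul_assoc]
        · rw [if_neg (not_le.mpr h0)] at hR ⊢
          rw [inv_inv]
          obtain ⟨Z', h⟩ := exists_step_repack hzi1 hA₂ hB₂ (le_max_right B₁ B₂) core₂ hR hM₂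
            (le_trans (by omega : max B₁ B₂ ≤ m.natAbs) le_rfl)
          refine ⟨Z', ?_⟩
          rw [← h, zpow_eq_pow_of_nonneg z (show 0 ≤ -m by omega), Int.natAbs_neg]
          congr 1
          simp only [mul_assoc]
      | false =>
        have htl' : (ys.getLast hys).1 = true := by
          cases h : (ys.getLast hys).1
          · exact absurd h htl
          · rfl
        simp only [htl', ↓reduceIte] at hR
        simp only [Bool.toNat_false, Nat.cast_zero, mul_zero, zpow_zero, neg_zero, one_mul, mul_one,
          Bool.false_eq_true, ↓reduceIte]
        rw [zpow_zero, mul_one] at hR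
        rcases le_or_gt 0 m with h0 | h0
        · rw [if_pos h0] at hR ⊢
          obtain ⟨Z', h⟩ := exists_step_repack hzi1 hA₂ hB₂ (le_max_right B₁ B₂) core₂ hR hM₂
            (le_trans (by omega : max B₁ B₂ ≤ m.natAbs) le_rfl)
          refine ⟨Z', ?_⟩
          rw [← h, zpow_eq_pow_of_nonneg z h0]
          congr 1
          simp only [mul_assoc]
        · rw [if_neg (not_le.mpr h0)] at hR ⊢
          rw [inv_inv] at hR
          obtain ⟨Z', h⟩ := exists_step_repack hz1 hA₁ hB₁ (le_max_left B₁ B₂) core₁ hR hM₁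
            (le_trans (by omega : max B₁ B₂ ≤ m.natAbs) le_rfl)
          refine ⟨Z', ?_⟩
          rw [← h, zpow_eq_pow_of_neg z h0]
          congr 1
          simp only [mul_assoc]

/-- **Big powers, alternating form, for cyclically reduced `z`.** [cite: Baumslag1962, Prop. 1] -/
theorem alternating_of_isCyclicallyReduced (hz : FreeGroup.IsCyclicallyReduced z.toWord)
    (hz1 : z ≠ 1) (c : ℤ) (ys : List (Bool × FreeGroup α)) (hne : ys ≠ [])
    (halt : ys.IsChain (fun a b => a.1 ≠ b.1)) (hy : ∀ y ∈ ys, ¬ Commute y.2 z) :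
    ∃ N : ℕ, ∀ m : ℤ, (N : ℤ) ≤ |m| →
      z ^ c * (ys.map fun y => z ^ (m * (y.1.toNat : ℤ)) * y.2 * z ^ (-(m * (y.1.toNat : ℤ)))).prod
        ≠ 1 := by
  have hV : z.toWord ≠ [] := fun e => hz1 (FreeGroup.toWord_eq_nil_iff.mp e)
  obtain ⟨init, ⟨tk, yk⟩, rfl⟩ : ∃ init last, ys = init ++ [last] :=
    ⟨ys.dropLast, ys.getLast hne, (dropLast_append_getLast hne).symm⟩
  have hlast : (init ++ [(tk, yk)]).getLast hne = (tk, yk) := by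
    rw [getLast_append_of_ne_nil _ (cons_ne_nil _ _)]; rfl
  cases tk with
  | true =>
    -- the product ends with the block `z^{-m}`: it is long, hence nontrivial
    obtain ⟨N, cst, -, H⟩ := alternating_invariant hz hz1 c (init ++ [(true, yk)]) hne halt hy
    refine ⟨N + cst + 1, fun m hm h1 => ?_⟩
    have hm' : N + cst + 1 ≤ m.natAbs := by
      rw [← Int.natCast_natAbs] at hm; exact_mod_cast hm
    obtain ⟨-, Z, hZ⟩ := H m (by rw [← Int.natCast_natAbs]; exact_mod_cast (by omega : N ≤ m.natAbs))
    rw [hlast] at hZ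
    simp only [↓reduceIte, zpow_zero, mul_one] at hZ
    rw [h1, FreeGroup.toWord_one] at hZ
    have hlen := congrArg List.length hZ
    rw [length_nil, length_append, length_flatten_replicate'] at hlen
    have hw : 0 < (if 0 ≤ m then z⁻¹ else z⁻¹⁻¹).toWord.length := by
      rw [length_pos_iff]
      split
      · rw [FreeGroup.toWord_inv]
        exact fun e => hV (FreeGroup.invRev_injective (by rw [e, FreeGroup.invRev_empty]))
      · rw [inv_inv]; exact hV
    have : 0 < (m.natAbs - cst) * (if 0 ≤ m then z⁻¹ else z⁻¹⁻¹).toWord.length :=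
      Nat.mul_pos (by omega) hw
    omega
  | false =>
    by_cases hinit : init = []
    · -- a single factor `z^c · y`
      subst hinit
      refine ⟨0, fun m _ h1 => hy (false, yk) (by simp) ?_⟩
      simp only [nil_append, map_cons, map_nil, prod_cons, prod_nil, Bool.toNat_false,
        Nat.cast_zero, mul_zero, zpow_zero, one_mul, neg_zero, mul_one] at h1
      -- `z^c * yk = 1` ⇒ `yk = z^{-c}` commutes with `z`
      have e : yk = z ^ (-c) := by
        rw [zpow_neg]; exact eq_inv_of_mul_eq_one_right h1
      change Commute yk z
      rw [e]
      exact Commute.zpow_left (Commute.refl z) _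
    · -- `init` ends with the block `z^m` (its last flag is `true`); then multiply by `yk`
      have halt' : init.IsChain (fun a b => a.1 ≠ b.1) := (isChain_append.mp halt).1
      have hy' : ∀ y ∈ init, ¬ Commute y.2 z := fun y hyy => hy y (mem_append_left _ hyy)
      have htl : (init.getLast hinit).1 = true := by
        have h := (isChain_append.mp halt).2.2 (init.getLast hinit)
          (by rw [Option.mem_def, getLast?_eq_some_getLast hinit]) (false, yk) (by simp)
        cases h' : (init.getLast hinit).1
        · exact absurd h' h
        · rfl
      obtain ⟨N, cst, -, H⟩ := alternating_invariant hz hz1 c init hinit halt' hy'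
      refine ⟨N + cst + yk.toWord.length + 1, fun m hm => ?_⟩
      have hm' : N + cst + yk.toWord.length + 1 ≤ m.natAbs := by
        rw [← Int.natCast_natAbs] at hm; exact_mod_cast hm
      obtain ⟨-, Z, hZ⟩ := H m (by rw [← Int.natCast_natAbs]; exact_mod_cast (by omega : N ≤ m.natAbs))
      simp only [htl, ↓reduceIte, zpow_zero, mul_one] at hZ
      rw [map_append, prod_append, map_cons, map_nil, prod_cons, prod_nil]
      simp only [Bool.toNat_false, Nat.cast_zero, mul_zero, zpow_zero, one_mul, neg_zero, mul_one,
        ← mul_assoc]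
      refine mul_ne_one_of_toWord hZ ?_
      have hw : 0 < (if 0 ≤ m then z⁻¹ else z⁻¹⁻¹).toWord.length := by
        rw [length_pos_iff]
        split
        · rw [FreeGroup.toWord_inv]
          exact fun e => hV (FreeGroup.invRev_injective (by rw [e, FreeGroup.invRev_empty]))
        · rw [inv_inv]; exact hV
      calc yk.toWord.length < m.natAbs - cst := by omega
        _ = (m.natAbs - cst) * 1 := (Nat.mul_one _).symm
        _ ≤ (m.natAbs - cst) * (if 0 ≤ m then z⁻¹ else z⁻¹⁻¹).toWord.length :=
          Nat.mul_le_mul_left _ hw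

end Alternating

end FreeGroupBigPowers

/-! ### The theorem, for an arbitrary `z ≠ 1` -/

open FreeGroupBigPowers in
/-- **Baumslag's big powers lemma, alternating (Dehn-twist) form.**  Let `z ≠ 1` in a free group,
`c ∈ ℤ`, and let `(t₁, y₁), …, (t_k, y_k)` (`k ≥ 1`) be a list with ALTERNATING flags
`tⱼ ≠ tⱼ₊₁` and with no `yⱼ` commuting with `z`.  Then for all `m` with `|m|` large enough,
`z^c · ∏ⱼ z^{m tⱼ} yⱼ z^{-m tⱼ} ≠ 1` — i.e. `z^{c + m t₁} y₁ z^{±m} y₂ z^{∓m} ⋯ y_k z^{-m t_k} ≠ 1`: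
the big powers of `z` between non-commuting elements cannot cancel (G. Baumslag, *On generalised
free products*, Math. Z. 78 (1962), Prop. 1 / Prop. 1: free groups have the "big powers"
property).  This is the hypothesis `hBP` of the amalgam combination lemma
`AmalgamDiscrimination.exists_twistLift_forall_ne_one`.  Proof: conjugate `z` to a cyclically
reduced element and apply `FreeGroupBigPowers.alternating_of_isCyclicallyReduced`.
[cite: Baumslag1962, Prop. 1] -/
theorem _root_.FreeGroup.exists_bigPowers_alternating {ι : Type*} (z : FreeGroup ι) (hz : z ≠ 1)
    (c : ℤ) (ys : List (Bool × FreeGroup ι)) (hne : ys ≠ [])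
    (halt : ys.IsChain (fun a b => a.1 ≠ b.1)) (hy : ∀ y ∈ ys, ¬ Commute y.2 z) :
    ∃ N : ℕ, ∀ m : ℤ, (N : ℤ) ≤ |m| →
      z ^ c * (ys.map fun y => z ^ (m * (y.1.toNat : ℤ)) * y.2 * z ^ (-(m * (y.1.toNat : ℤ)))).prod
        ≠ 1 := by
  classical
  -- cyclic reduction `z = k · z₀ · k⁻¹`
  set K := FreeGroup.reduceCyclically.conjugator z.toWord with hK
  set C := FreeGroup.reduceCyclically z.toWord with hC
  set k := FreeGroup.mk K with hk
  set z₀ := FreeGroup.mk C with hz₀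
  have hCred : FreeGroup.IsCyclicallyReduced C :=
    FreeGroup.reduceCyclically.isCyclicallyReduced FreeGroup.isReduced_toWord
  have hz₀w : z₀.toWord = C := by
    rw [hz₀, FreeGroup.toWord_mk, hCred.isReduced.reduce_eq]
  have hz₀cr : FreeGroup.IsCyclicallyReduced z₀.toWord := by rw [hz₀w]; exact hCred
  have hzk : z = k * z₀ * k⁻¹ := by
    rw [hk, hz₀, FreeGroup.inv_mk, FreeGroup.mul_mk, FreeGroup.mul_mk,
      FreeGroup.reduceCyclically.conj_conjugator_reduceCyclically, FreeGroup.mk_toWord]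
  have hz₀1 : z₀ ≠ 1 := by
    intro h; apply hz; rw [hzk, h, mul_one, mul_inv_cancel]
  have hφ : ∀ x : FreeGroup ι, MulAut.conj k x = k * x * k⁻¹ := fun x => MulAut.conj_apply k x
  -- the conjugated list
  set ys₀ : List (Bool × FreeGroup ι) := ys.map fun y => (y.1, k⁻¹ * y.2 * k) with hys₀
  have hne₀ : ys₀ ≠ [] := by simpa [hys₀] using hne
  have halt₀ : ys₀.IsChain (fun a b => a.1 ≠ b.1) := by
    rw [hys₀, isChain_map]; exact halt
  have hy₀ : ∀ y ∈ ys₀, ¬ Commute y.2 z₀ := by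
    intro y hy0 hc
    rw [hys₀, mem_map] at hy0
    obtain ⟨y', hy', rfl⟩ := hy0
    apply hy y' hy'
    have e : y'.2 = k * (k⁻¹ * y'.2 * k) * k⁻¹ := by group
    rw [hzk, e]
    change (k * (k⁻¹ * y'.2 * k) * k⁻¹) * (k * z₀ * k⁻¹) = (k * z₀ * k⁻¹) * (k * (k⁻¹ * y'.2 * k) * k⁻¹)
    have := hc.eq
    calc k * (k⁻¹ * y'.2 * k) * k⁻¹ * (k * z₀ * k⁻¹) = k * ((k⁻¹ * y'.2 * k) * z₀) * k⁻¹ := by group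
      _ = k * (z₀ * (k⁻¹ * y'.2 * k)) * k⁻¹ := by rw [this]
      _ = k * z₀ * k⁻¹ * (k * (k⁻¹ * y'.2 * k) * k⁻¹) := by group
  obtain ⟨N, hN⟩ := alternating_of_isCyclicallyReduced hz₀cr hz₀1 c ys₀ hne₀ halt₀ hy₀
  refine ⟨N, fun m hm h1 => hN m hm ?_⟩
  -- transport the relation through conjugation by `k`
  have key : z ^ c * (ys.map fun y => z ^ (m * (y.1.toNat : ℤ)) * y.2 *
      z ^ (-(m * (y.1.toNat : ℤ)))).prod =
      MulAut.conj k (z₀ ^ c * (ys₀.map fun y => z₀ ^ (m * (y.1.toNat : ℤ)) * y.2 *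
        z₀ ^ (-(m * (y.1.toNat : ℤ)))).prod) := by
    rw [map_mul, map_zpow, hφ z₀, ← hzk, map_list_prod, hys₀, map_map, map_map]
    congr 2
    refine map_congr_left fun y _ => ?_
    simp only [Function.comp_apply, hφ]
    rw [hzk, conj_zpow, conj_zpow]
    group
  rw [key] at h1
  exact (MulEquiv.map_eq_one_iff (MulAut.conj k)).mp h1

end Literature.GroupTheory.CombinatorialGroupTheory
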